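import Literature.Probability.Percolation.SlabMSFLanding
import Summits.CriticalPhenomena.PercolationContinuityZ3.Theorems.PercAnnulusCrossingInvasionAbsorption
import Summits.CriticalPhenomena.PercolationContinuityZ3.Theorems.PercAnnulusCrossingInvasionLocalityEdges
import Summits.CriticalPhenomena.PercolationContinuityZ3.Theorems.PercAnnulusCrossingSlabMSFMeasurability
import HarnessLib

/-!
# RSW3 lane (lead, gen 45): NTW 2017 §4 — THE LANDING DATA, I: break-out facts and the landing vertex `z(ω)` of the invasion
# on `∂R`, with its locality under the surgery (file F5, first part, of the build-out of Theorem 2.4)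

builds on p205010 (kernel theorem, internal audit signed; external expert review pending) — NOT used in this file.

Cell `prim-rsw3`, lead seat (gen 45), blueprint `prim-rsw3-lead/gen44/BUILDOUT-PLAN.md` §2.  Support file
(`--supports stmt-CriticalPhenomena-4575`); no definitions, no named facts, no sorries.  Vocabulary: the tree's vertex invasion
(`Invasion.invasion G U o n = I_n`, `exitIndex = n_Λ`, `exitVertex`, `InvasionPercolation.lean`), NTW's inside `R`/`∂R`/`R ∖ ∂R`
(`SlabMSFInside.lean`), landing column / connectors / plus cylinder (`SlabMSFConnector.lean`), and the landing data of
`SlabMSFLanding.lean`: `insideFin k Γ N` (= `R ∖ ∂R`), `zHat k Γ N U a` (NTW's `z(ω)`, the break-out vertex of the invasion of `a`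
from `R ∖ ∂R`), `wDom k Γ z M = Λ_M ∖ B̄₁^#(z′)`, `wHat k Γ z M U b` (NTW's `w`), with `Λ_M = ballFinset k 0 M` the column ball `B̄_M`
(NTW's invasion "stopped when it first reaches any vertex in `∂B̄_{m_i}`" is the tree's invasion stopped at its break-out of
`Λ_{m_i - 1}`; below `M = m_i - 1`).

Newman–Tassion–Wu (arXiv:1512.09107, §4.1, proof of Lemma 4.1, pp. 20–21), for `ω ∈ (𝓑_0)^c ∩ 𝓑_x ∩ C ∩ D`:
«Let `τ_i = min{j : 𝓘_0[j] ∈ ∂R}` and `z(ω) = 𝓘_0[τ_i]` be the first landing point of `𝓘_0` on `∂R`. By definition, there exists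
`z′ ∈ Γ_min` such that `dist(z̄, z̄′) = 1` … `w = 𝓘_x[τ_i^x]` the first vertex in `∂B̄₁^#(z′)` reached by the invasion cluster
starting from `x` … `(𝓑_0)^c` implies (f1) `z(ω) ∉ C_{p_c}(Γ_min(ω))` … `R(ω′) = R(ω)` and `ω|_R = ω′|_R`. This implies
`z(ω) = z(ω′)`.»  This file proves, for EVERY label field and every vertex list `Γ` that is a surrounding open circuit of
`Ā_{n,N}` (the use is `Γ = Γ_min`):

* general break-out facts on any locally finite graph (`exists_exitDart`, `exitVertex_not_mem`, `exitVertex_mem_invasion`,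
  `exitIndex_mono`, `lt_exitIndex_of_subset`, `mem_stoppedInvasion_of_agree`); that the invasion of the slab leaves every
  finite set is p1's `exists_not_subset_invasion_slab` (`PercAnnulusCrossingSlabMSFMeasurability.lean`);
* **`zHat_mem_insideBdry`** (`z ∈ ∂R`), `exists_planarAdj_zHat` (the column `z′`), `zHat_not_mem` (`z ∉ Γ`),
  `planar_zHat_mem_sqBox` (`z̄ ∈ B_N`), `invasion_zIndex_subset_inside` (up to the landing the invasion is inside `R ⊆ B̄_N`),
  `zHat_mem_stoppedInvasion` (`z ∈ 𝓘_a^{M}` for `N ≤ M`);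
* LOCALITY **`zHat_congr`**: label fields agreeing off the pairs inside the plus cylinder `B̄₁^#(y)` of a column `y` of `Γ`
  have the same `z`, the same landing time and the same invasion up to it.
The plus-entry vertex `w` of Step 2, its locality, the blocked-absorption instances at the scale and (f1) are in the second
part `PercAnnulusCrossingSlabMSFLandingW.lean`.

References: C. M. Newman, V. Tassion, W. Wu, *Critical percolation and the minimal spanning tree in slabs*, CPAM 70 (2017),
arXiv:1512.09107, §4.1 pp. 20–21 [NewmanTassionWu2017]; J. T. Chayes, L. Chayes, C. M. Newman, Comm. Math. Phys. 101 (1985) §3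
(break-out of `Λ_m`) [ChayesChayesNewman1985].
-/

noncomputable section

namespace Summit.CriticalPhenomena.PercolationContinuityZ3.Theorems.Crossing

open Literature.Probability.Percolation Literature.Probability.LatticeModels
open Literature.Probability.Percolation.NTW17 Literature.Probability.Percolation.Invasion

/-! ## Break-out facts on a locally finite graph -/

section General

variable {V : Type*} [DecidableEq V] {G : SimpleGraph V} [G.LocallyFinite] {U U' : Sym2 V → ℝ} {o : V} {Λ Λ' : Finset V}

/-- A region inside `Λ` is reached before the break-out of `Λ`: `I_n ⊆ Λ ⇒ n < n_Λ`. [cite: ChayesChayesNewman1985, §3 proof of Thm 3.2 (n_Λ)] -/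
theorem lt_exitIndex_of_subset (hex : ∃ n, ¬ invasion G U o n ⊆ Λ) {n : ℕ} (hn : invasion G U o n ⊆ Λ) :
    n < exitIndex G U o Λ := by
  by_contra h
  exact (exitIndex_spec G hex).1 ((Rsw3.invasion_mono U o (not_lt.1 h)).trans hn)

/-- The break-out time is positive when the root lies in `Λ`. [cite: ChayesChayesNewman1985, §3 proof of Thm 3.2 (n_Λ)] -/
theorem exitIndex_pos (ho : o ∈ Λ) (hex : ∃ n, ¬ invasion G U o n ⊆ Λ) : 0 < exitIndex G U o Λ :=
  lt_exitIndex_of_subset hex (by rw [invasion_zero]; exact Finset.singleton_subset_iff.2 ho)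

/-- **Break-out times are monotone in the set.** [cite: ChayesChayesNewman1985, §3 proof of Thm 3.2 (n_Λ)] -/
theorem exitIndex_mono (hΛ : Λ ⊆ Λ') (hex' : ∃ n, ¬ invasion G U o n ⊆ Λ') :
    exitIndex G U o Λ ≤ exitIndex G U o Λ' := by
  have hex : ∃ n, ¬ invasion G U o n ⊆ Λ := by
    obtain ⟨n, hn⟩ := hex'
    exact ⟨n, fun h => hn (h.trans hΛ)⟩
  by_contra hlt
  exact (exitIndex_spec G hex').1 (((exitIndex_spec G hex).2 _ (not_le.1 hlt)).trans hΛ)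

/-- **The break-out dart.** At time `n_Λ - 1` a dart `a` is absorbed with `a.1 ∈ I_{n_Λ - 1} ⊆ Λ`, `a.2 ∉ Λ`, `a.1 ∼ a.2`, and
`I_{n_Λ} = insert a.2 I_{n_Λ - 1}`. [cite: ChayesChayesNewman1985, §3 proof of Thm 3.2 (the break-out site s ∈ ∂Λ_m)] -/
theorem exists_exitDart (ho : o ∈ Λ) (hex : ∃ n, ¬ invasion G U o n ⊆ Λ) :
    ∃ a : V × V, newDart G U (invasion G U o (exitIndex G U o Λ - 1)) = some a ∧
      a.1 ∈ invasion G U o (exitIndex G U o Λ - 1) ∧ a.2 ∉ Λ ∧ G.Adj a.1 a.2 ∧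
      invasion G U o (exitIndex G U o Λ - 1) ⊆ Λ ∧
      invasion G U o (exitIndex G U o Λ) = insert a.2 (invasion G U o (exitIndex G U o Λ - 1)) := by
  set T := exitIndex G U o Λ with hT
  obtain ⟨hnot, hbefore⟩ := exitIndex_spec G hex
  rw [← hT] at hnot hbefore
  have hpos : 0 < T := exitIndex_pos ho hex
  have hsub : invasion G U o (T - 1) ⊆ Λ := hbefore _ (Nat.sub_lt hpos one_pos)
  have hstep : invasion G U o T = step G U (invasion G U o (T - 1)) := by
    conv_lhs => rw [show T = T - 1 + 1 by omega]
    rfl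
  cases hd : newDart G U (invasion G U o (T - 1)) with
  | none => exact absurd (by rw [hstep, step_of_eq_none _ hd]; exact hsub) hnot
  | some a =>
    have hI : invasion G U o T = insert a.2 (invasion G U o (T - 1)) := by rw [hstep, step_of_eq_some _ hd]
    refine ⟨a, rfl, Rsw3.fst_mem_of_newDart hd, fun ha => hnot ?_, Rsw3.adj_of_newDart hd, hsub, hI⟩
    rw [hI]
    exact Finset.insert_subset ha hsub

/-- The break-out vertex lies outside `Λ`. [cite: ChayesChayesNewman1985, §3 proof of Thm 3.2 (s ∈ ∂Λ_m)] -/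
theorem exitVertex_not_mem (ho : o ∈ Λ) (hex : ∃ n, ¬ invasion G U o n ⊆ Λ) : exitVertex G U o Λ ∉ Λ := by
  obtain ⟨a, ha, -, hout, -⟩ := exists_exitDart ho hex
  rwa [exitVertex_of_eq_some _ ha]

/-- The break-out vertex is invaded at the break-out time. [cite: ChayesChayesNewman1985, §3 proof of Thm 3.2] -/
theorem exitVertex_mem_invasion (ho : o ∈ Λ) (hex : ∃ n, ¬ invasion G U o n ⊆ Λ) :
    exitVertex G U o Λ ∈ invasion G U o (exitIndex G U o Λ) := by
  obtain ⟨a, ha, -, -, -, -, hI⟩ := exists_exitDart ho hex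
  rw [exitVertex_of_eq_some _ ha, hI]
  exact Finset.mem_insert_self _ _

/-- The break-out vertex is adjacent to a vertex invaded before the break-out (which lies in `Λ`).
[cite: ChayesChayesNewman1985, §3 proof of Thm 3.2] -/
theorem exists_adj_exitVertex (ho : o ∈ Λ) (hex : ∃ n, ¬ invasion G U o n ⊆ Λ) :
    ∃ u ∈ invasion G U o (exitIndex G U o Λ - 1), G.Adj u (exitVertex G U o Λ) := by
  obtain ⟨a, ha, h1, -, hadj, -⟩ := exists_exitDart ho hex
  rw [exitVertex_of_eq_some _ ha]
  exact ⟨a.1, h1, hadj⟩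

/-- Up to the break-out, everything invaded lies in `Λ ∪ {s}`. [cite: ChayesChayesNewman1985, §3 proof of Thm 3.2] -/
theorem invasion_exitIndex_eq_insert (ho : o ∈ Λ) (hex : ∃ n, ¬ invasion G U o n ⊆ Λ) :
    invasion G U o (exitIndex G U o Λ) = insert (exitVertex G U o Λ) (invasion G U o (exitIndex G U o Λ - 1)) ∧
      invasion G U o (exitIndex G U o Λ - 1) ⊆ Λ := by
  obtain ⟨a, ha, -, -, -, hsub, hI⟩ := exists_exitDart ho hex
  rw [exitVertex_of_eq_some _ ha]
  exact ⟨hI, hsub⟩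

/-- **Transfer of a stopped invasion under agreement.** If two label fields have the same invasion up to time `σ`, and `I_σ ⊆ Λ'`,
then every vertex of `I_σ` lies in the invasion of the second field stopped at its break-out of `Λ'` (the break-out of `Λ'`
under the second field happens after `σ`). [cite: NewmanTassionWu2017, §4.1 (proof of Lemma 4.1: "ω′ ∈ 𝓑_0 ∩ 𝓑_x")] -/
theorem mem_stoppedInvasion_of_agree (hex' : ∃ n, ¬ invasion G U' o n ⊆ Λ') {σ : ℕ}
    (hagree : ∀ j ≤ σ, invasion G U o j = invasion G U' o j) (hσ : invasion G U o σ ⊆ Λ') {v : V}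
    (hv : v ∈ invasion G U o σ) : v ∈ invasion G U' o (exitIndex G U' o Λ') := by
  have hσ' : invasion G U' o σ ⊆ Λ' := by rwa [← hagree σ le_rfl]
  have hlt := lt_exitIndex_of_subset hex' hσ'
  exact Rsw3.invasion_mono U' o hlt.le (by rw [← hagree σ le_rfl]; exact hv)

end General


/-! ## `z(ω)`: the landing of the invasion of `a` on `∂R` -/

section Landing

variable {k : ℕ} {ω : BondConfig (slab 3 k)} {Γ : List (slab 3 k)} {n N : ℕ}

/-- **The landing facts.**  For a surrounding open circuit `Γ` of `Ā_{n,N}` in a lattice configuration and a root `a ∈ R ∖ ∂R`: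
`z = zHat` lies in `∂R`, outside `Γ`, over `B_N`, is invaded at the landing time, and up to the landing time the invasion is
inside `R`. [cite: NewmanTassionWu2017, §4.1 (proof of Lemma 4.1: τ_i, z(ω) ∈ ∂R, z′)] -/
theorem zHat_spec (hω : ω ⊆ (slabGraph 3 k).edgeSet)
    (hΓ : IsOpenCircuit k ω (slabLift k (annulus ((0 : ℤ), (0 : ℤ)) n N)) Γ) (hs : Surrounds k ((0 : ℤ), (0 : ℤ)) Γ)
    {U : Sym2 (slab 3 k) → ℝ} {a : slab 3 k} (ha : a ∈ insideFin k Γ N) :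
    zHat k Γ N U a ∈ insideBdry k Γ ∧
      zHat k Γ N U a ∈ invasion (slabGraph 3 k) U a (exitIndex (slabGraph 3 k) U a (insideFin k Γ N)) ∧
      (↑(invasion (slabGraph 3 k) U a (exitIndex (slabGraph 3 k) U a (insideFin k Γ N))) : Set (slab 3 k)) ⊆ inside k Γ := by
  have hex := exists_not_subset_invasion_slab U a (insideFin k Γ N)
  obtain ⟨hI, hsub⟩ := invasion_exitIndex_eq_insert ha hex
  obtain ⟨u, hu, hadj⟩ := exists_adj_exitVertex ha hex
  have huInt : u ∈ insideInt k Γ := mem_insideInt_of_mem_insideFin (hsub hu)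
  have hzR : zHat k Γ N U a ∈ inside k Γ := mem_inside_of_adj_of_mem_insideInt huInt hadj
  have hznot : zHat k Γ N U a ∉ insideInt k Γ := fun h =>
    exitVertex_not_mem ha hex ((mem_insideFin_iff_mem_insideInt hω hΓ hs).2 h)
  refine ⟨⟨hzR, ?_⟩, exitVertex_mem_invasion ha hex, ?_⟩
  · by_contra hno
    exact hznot ⟨hzR, fun hb => hno hb.2⟩
  · intro v hv
    rw [Finset.mem_coe, show invasion (slabGraph 3 k) U a (exitIndex (slabGraph 3 k) U a (insideFin k Γ N)) =
      insert (exitVertex (slabGraph 3 k) U a (insideFin k Γ N))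
        (invasion (slabGraph 3 k) U a (exitIndex (slabGraph 3 k) U a (insideFin k Γ N) - 1)) from hI,
      Finset.mem_insert] at hv
    rcases hv with rfl | hv
    · exact hzR
    · exact (mem_insideInt_of_mem_insideFin (hsub hv)).1

/-- `z ∈ ∂R`. [cite: NewmanTassionWu2017, §4.1 (z(ω) "the first landing point of 𝓘_0 on ∂R")] -/
theorem zHat_mem_insideBdry (hω : ω ⊆ (slabGraph 3 k).edgeSet)
    (hΓ : IsOpenCircuit k ω (slabLift k (annulus ((0 : ℤ), (0 : ℤ)) n N)) Γ) (hs : Surrounds k ((0 : ℤ), (0 : ℤ)) Γ)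
    {U : Sym2 (slab 3 k) → ℝ} {a : slab 3 k} (ha : a ∈ insideFin k Γ N) : zHat k Γ N U a ∈ insideBdry k Γ :=
  (zHat_spec hω hΓ hs ha).1

/-- **The landing column exists**: some column of `Γ` is adjacent to the column of `z` (NTW's `z′`).
[cite: NewmanTassionWu2017, §4.1 ("there exists z′ ∈ Γ_min such that dist(z̄, z̄′) = 1")] -/
theorem exists_planarAdj_zHat (hω : ω ⊆ (slabGraph 3 k).edgeSet)
    (hΓ : IsOpenCircuit k ω (slabLift k (annulus ((0 : ℤ), (0 : ℤ)) n N)) Γ) (hs : Surrounds k ((0 : ℤ), (0 : ℤ)) Γ)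
    {U : Sym2 (slab 3 k) → ℝ} {a : slab 3 k} (ha : a ∈ insideFin k Γ N) :
    ∃ g ∈ Γ, planarAdj (planar k (zHat k Γ N U a)) (planar k g) :=
  exists_planarAdj_of_mem_insideBdry (zHat_mem_insideBdry hω hΓ hs ha)

/-- The landing column `z′` carries a vertex of `Γ`. [cite: NewmanTassionWu2017, §4.1 (z′ ∈ Γ_min)] -/
theorem exists_planar_eq_landCol_zHat (hω : ω ⊆ (slabGraph 3 k).edgeSet)
    (hΓ : IsOpenCircuit k ω (slabLift k (annulus ((0 : ℤ), (0 : ℤ)) n N)) Γ) (hs : Surrounds k ((0 : ℤ), (0 : ℤ)) Γ)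
    {U : Sym2 (slab 3 k) → ℝ} {a : slab 3 k} (ha : a ∈ insideFin k Γ N) :
    ∃ g ∈ Γ, planar k g = landCol k Γ (zHat k Γ N U a) :=
  (landCol_spec (exists_planarAdj_zHat hω hΓ hs ha)).1

/-- `z ∉ Γ` (`z ∈ R`, which avoids the columns of `Γ`). [cite: NewmanTassionWu2017, §4.1 (z(ω) ∈ ∂R ⊆ R)] -/
theorem zHat_not_mem (hω : ω ⊆ (slabGraph 3 k).edgeSet)
    (hΓ : IsOpenCircuit k ω (slabLift k (annulus ((0 : ℤ), (0 : ℤ)) n N)) Γ) (hs : Surrounds k ((0 : ℤ), (0 : ℤ)) Γ)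
    {U : Sym2 (slab 3 k) → ℝ} {a : slab 3 k} (ha : a ∈ insideFin k Γ N) : zHat k Γ N U a ∉ Γ :=
  fun h => not_mem_inside_of_mem h (zHat_mem_insideBdry hω hΓ hs ha).1

/-- `z` is invaded at the landing time `τ = n_{R ∖ ∂R}`. [cite: NewmanTassionWu2017, §4.1 (z(ω) = 𝓘_0[τ_i])] -/
theorem zHat_mem_invasion (hω : ω ⊆ (slabGraph 3 k).edgeSet)
    (hΓ : IsOpenCircuit k ω (slabLift k (annulus ((0 : ℤ), (0 : ℤ)) n N)) Γ) (hs : Surrounds k ((0 : ℤ), (0 : ℤ)) Γ)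
    {U : Sym2 (slab 3 k) → ℝ} {a : slab 3 k} (ha : a ∈ insideFin k Γ N) :
    zHat k Γ N U a ∈ invasion (slabGraph 3 k) U a (exitIndex (slabGraph 3 k) U a (insideFin k Γ N)) :=
  (zHat_spec hω hΓ hs ha).2.1

/-- **Up to the landing time the invasion is inside `R`** (hence over `B_N`). [cite: NewmanTassionWu2017, §4.1 (𝓘_0 explored inside R until it contains z)] -/
theorem invasion_zIndex_subset_inside (hω : ω ⊆ (slabGraph 3 k).edgeSet)
    (hΓ : IsOpenCircuit k ω (slabLift k (annulus ((0 : ℤ), (0 : ℤ)) n N)) Γ) (hs : Surrounds k ((0 : ℤ), (0 : ℤ)) Γ)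
    {U : Sym2 (slab 3 k) → ℝ} {a : slab 3 k} (ha : a ∈ insideFin k Γ N) :
    (↑(invasion (slabGraph 3 k) U a (exitIndex (slabGraph 3 k) U a (insideFin k Γ N))) : Set (slab 3 k)) ⊆ inside k Γ :=
  (zHat_spec hω hΓ hs ha).2.2

/-- Up to the landing time the invasion lies in the column ball `Λ_M` for every `M ≥ N`.
[cite: NewmanTassionWu2017, §4.1 (R(ω) ⊆ B̄_{2n_i})] -/
theorem invasion_zIndex_subset_ballFinset (hω : ω ⊆ (slabGraph 3 k).edgeSet)
    (hΓ : IsOpenCircuit k ω (slabLift k (annulus ((0 : ℤ), (0 : ℤ)) n N)) Γ) (hs : Surrounds k ((0 : ℤ), (0 : ℤ)) Γ)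
    {U : Sym2 (slab 3 k) → ℝ} {a : slab 3 k} (ha : a ∈ insideFin k Γ N) {M : ℕ} (hNM : N ≤ M) :
    invasion (slabGraph 3 k) U a (exitIndex (slabGraph 3 k) U a (insideFin k Γ N)) ⊆ ballFinset k ((0 : ℤ), (0 : ℤ)) M := by
  intro v hv
  rw [mem_ballFinset]
  exact slabLift_mono k (sqBox_mono _ hNM)
    (inside_subset_slabLift_sqBox hω hΓ hs (invasion_zIndex_subset_inside hω hΓ hs ha (Finset.mem_coe.2 hv)))

/-- `z̄ ∈ B_N`. [cite: NewmanTassionWu2017, §4.1 (z(ω) ∈ R ⊆ B̄_{2n_i})] -/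
theorem planar_zHat_mem_sqBox (hω : ω ⊆ (slabGraph 3 k).edgeSet)
    (hΓ : IsOpenCircuit k ω (slabLift k (annulus ((0 : ℤ), (0 : ℤ)) n N)) Γ) (hs : Surrounds k ((0 : ℤ), (0 : ℤ)) Γ)
    {U : Sym2 (slab 3 k) → ℝ} {a : slab 3 k} (ha : a ∈ insideFin k Γ N) :
    planar k (zHat k Γ N U a) ∈ sqBox ((0 : ℤ), (0 : ℤ)) N :=
  (mem_slabLift_iff k _ _).1 (inside_subset_slabLift_sqBox hω hΓ hs (zHat_mem_insideBdry hω hΓ hs ha).1)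

/-- The landing happens before the break-out of `Λ_M` (`τ < n_{Λ_M}`) for `M ≥ N`. [cite: NewmanTassionWu2017, §4.1 (𝓘_0^{m_i} contains z)] -/
theorem exitIndex_insideFin_lt (hω : ω ⊆ (slabGraph 3 k).edgeSet)
    (hΓ : IsOpenCircuit k ω (slabLift k (annulus ((0 : ℤ), (0 : ℤ)) n N)) Γ) (hs : Surrounds k ((0 : ℤ), (0 : ℤ)) Γ)
    {U : Sym2 (slab 3 k) → ℝ} {a : slab 3 k} (ha : a ∈ insideFin k Γ N) {M : ℕ} (hNM : N ≤ M) :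
    exitIndex (slabGraph 3 k) U a (insideFin k Γ N) < exitIndex (slabGraph 3 k) U a (ballFinset k ((0 : ℤ), (0 : ℤ)) M) :=
  lt_exitIndex_of_subset (exists_not_subset_invasion_slab U a _) (invasion_zIndex_subset_ballFinset hω hΓ hs ha hNM)

/-- **`z ∈ 𝓘_a^{M}`**: the landing vertex belongs to the invasion of `a` stopped at its break-out of `Λ_M`, `M ≥ N`.
[cite: NewmanTassionWu2017, §4.1 (z ∈ 𝓘_0^{m_i})] -/
theorem zHat_mem_stoppedInvasion (hω : ω ⊆ (slabGraph 3 k).edgeSet)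
    (hΓ : IsOpenCircuit k ω (slabLift k (annulus ((0 : ℤ), (0 : ℤ)) n N)) Γ) (hs : Surrounds k ((0 : ℤ), (0 : ℤ)) Γ)
    {U : Sym2 (slab 3 k) → ℝ} {a : slab 3 k} (ha : a ∈ insideFin k Γ N) {M : ℕ} (hNM : N ≤ M) :
    zHat k Γ N U a ∈ invasion (slabGraph 3 k) U a (exitIndex (slabGraph 3 k) U a (ballFinset k ((0 : ℤ), (0 : ℤ)) M)) :=
  Rsw3.invasion_mono U a (exitIndex_insideFin_lt hω hΓ hs ha hNM).le (zHat_mem_invasion hω hΓ hs ha)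

/-- **Locality of the landing: `z(ω′) = z(ω)`.**  Two label fields agreeing off the pairs inside the plus cylinder `B̄₁^#(y)` of
a column `y` of `Γ` have the same landing vertex, the same landing time and the same invasion up to it (the pairs read by the
invasion before it leaves `R ∖ ∂R` touch `R ∖ ∂R`, which the cylinder avoids).
[cite: NewmanTassionWu2017, §4.1 (proof of Lemma 4.1, recovery: "ω|_R = ω′|_R. This implies z(ω) = z(ω′)")] -/
theorem zHat_congr {y : ℤ × ℤ} (hy : ∃ g ∈ Γ, planar k g = y) {U U' : Sym2 (slab 3 k) → ℝ}
    (h : ∀ e, e ∉ plusEdges k y → U e = U' e) {a : slab 3 k} (ha : a ∈ insideFin k Γ N) :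
    zHat k Γ N U' a = zHat k Γ N U a ∧
      exitIndex (slabGraph 3 k) U' a (insideFin k Γ N) = exitIndex (slabGraph 3 k) U a (insideFin k Γ N) ∧
      ∀ j ≤ exitIndex (slabGraph 3 k) U a (insideFin k Γ N),
        invasion (slabGraph 3 k) U a j = invasion (slabGraph 3 k) U' a j := by
  have hex := exists_not_subset_invasion_slab U a (insideFin k Γ N)
  have hagree := agree_adj_insideFin_of_agree_off_plusEdges hy (N := N) h
  exact ⟨Rsw3.exitVertex_congr_of_agree_adj ha hex hagree, Rsw3.exitIndex_congr_of_agree_adj hex hagree,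
    fun j hj => Rsw3.invasion_congr_of_agree_adj hex hagree hj⟩

end Landing

end Summit.CriticalPhenomena.PercolationContinuityZ3.Theorems.Crossing
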